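import Summits.Ventures.WeilGRH.TwistedGramEntryBox
import HarnessLib

/-!
# GRH arm (rh-explicit, venture WeilGRH): twisted format C — the SMALL-CELL checker, even sector
  (brick (E2) of the χ instance lane: Schur complement and order-1 tail in interval arithmetic ⇒ the door's `hSe`)

Cell `rh-explicit`, WEIL TRACK — GRH ARM (engine seat weil-grh-2 gen7).  Sequel of `TwistedGramEntryBox.lean` (E1).
For the χ cells the blocks are tiny (`B ≤ 48`, `B₃ ≤ 384`, deposit EXTREMALS/GRH/formatC-real-order1-CERT: 66/66 cells of the
real finite remainder certified at order 1), so — unlike the `ζ` K-cells (`B = 512`, `B₃ = 2·10⁵`, banded packed rows) — the WHOLE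
matrix of the door's even-sector kernel fact

  `S⁺(i,j) = M⁺(i,j) − Σ_{m∈[B,B₃)} M⁺(i,m)M⁺(j,m)/w_m − U₂⁺(i,j)`,  `M⁺ = Encl.evenKernel (twistedGramCoeff χ a)`

(`TwistedDataRung.weilPositivityOnChar_of_twisted_formatC_data`, hypothesis `hSe`) can be ENCLOSED ENTRYWISE in `MI` by the
kernel and handed to `PsdDyadic.psd_of_checkPsdMid`.  This file provides, for a real character `χ` with integer weights
`ε_i = Re χ(k_i)` on the window's prime data and rational cell data `(w_m, d₀, θ)` at unit `2^{−wbits}`: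

* `sigBox` (`∋ Σ = Σ_{k} Λ(k)k^{-1/2}`), `schurE` (`∋ Σ_m M⁺(i,m)M⁺(j,m)/w_m`), `u2E` (`∋ U₂⁺(i,j)` given boxes `CC ∋ a(1+E(2a))`,
  `Encl` constants), `cellE = evenBoxT − schurE − u2E`, and `checkCellE` = `Encl.enclCheck` of integer data `D` against every
  `cellE i j`, `i, j < B`;
* ★ `hSe_of_checkCellE` — SOUNDNESS: `checkCellE … D = true`, `PsdDyadic.checkPsdMid B δ ρ D L = true`, valid constants /
  table / scalar boxes ⇒ `∀ x, 0 ≤ Σ_i Σ_j x_i x_j S⁺(i,j)` in EXACTLY the shape of the door's `hSe` (with `we m = wN(m−B)/2^{wbits}`).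

The sign facts `h0e/hd0e/hwe` (far diagonals: `TwistedGramCellSigns.lean`) and the odd sector are the next bricks (FORMATC-CHI-LANE.md §5).
Everything is PROVED; computable `def`s with docstrings; no named facts; RH/GRH-free.
References: H. Yoshida (1992) §5–§7 [Yoshida1992HermitianForms]; R. E. Moore (1966) Ch. 3 [Moore1966].
-/

set_option autoImplicit false

open Real Complex Finset
open scoped BigOperators ArithmeticFunction.vonMangoldt

namespace Summit.Ventures.WeilGRH

open Literature.NumberTheory.LFunctions Literature.NumberTheory.LFunctions.Yoshida1992
open Literature.NumberTheory.LFunctions.Yoshida1992.Encl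
open Literature.Analysis.SpecialFunctions Literature.Analysis.ValidatedNumerics.NumericsMP

namespace TwistedEncl

variable {S : ℕ} {a : ℝ} {q : ℕ}

/-! ## Table-indexed sector box (even) -/

/-- Even-sector kernel box from the special-value table (`Encl.tget`). [cite: Yoshida1992HermitianForms, §6 (6.10) p. 303] -/
def evenBoxT (S : ℕ) (C : Consts) (εs : List ℤ) (LQ : MI) (tab : List IdxRec) (i m : ℕ) : MI :=
  evenBox S C εs LQ (tget tab i) (tget tab m) i m

/-- `evenBoxT ∋ M⁺(i,m)` for a table valid below `N > i, m`. [cite: Moore1966, Ch. 3 (interval arithmetic: inclusion property)] -/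
theorem mem_evenBoxT (hS : 0 < S) (ha0 : 0 < a) {ks : List PrimeLen} (hks : PrimeData a ks) {C : Consts}
    (hC : ConstsValid S a ks C) (χ : DirichletCharacter ℂ q) {εs : List ℤ}
    (hε : ∀ i < ks.length, (χ (((ks.getD i default).val : ℕ) : ZMod q)).re = ((εs.getD i 0 : ℤ) : ℝ))
    {LQ : MI} (hLQ : MI.mem S (Real.log q) LQ) {N : ℕ} {tab : List IdxRec} (hT : TabValid S a ks N tab)
    {i m : ℕ} (hi : i < N) (hm : m < N) :
    MI.mem S (evenKernel (twistedGramCoeff χ a) i m) (evenBoxT S C εs LQ tab i m) := by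
  unfold evenKernel evenBoxT
  exact mem_evenBox hS ha0 hks hC χ hε hLQ (hT i hi).1 (hT i hi).2 (hT m hm).1

/-! ## The Schur (column) sum -/

/-- `Σ_{c<n} M⁺(i,B+c)·M⁺(j,B+c)·2^{wbits}/wN_c` — the column sum of the Schur complement with rational weights
`w_{B+c} = wN_c·2^{−wbits}`. [cite: Yoshida1992HermitianForms, §7 pp. 305–312] -/
def schurE (S : ℕ) (C : Consts) (εs : List ℤ) (LQ : MI) (tab : List IdxRec) (wbits : ℕ) (wN : List ℕ)
    (B i j : ℕ) : ℕ → MI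
  | 0 => MI.ofInt S 0
  | c + 1 => (schurE S C εs LQ tab wbits wN B i j c).add
      ((((evenBoxT S C εs LQ tab i (B + c)).mul S (evenBoxT S C εs LQ tab j (B + c))).mulInt ((2 : ℤ) ^ wbits)).divNat
        (wN.getD c 0))

/-- Soundness of `schurE`. [cite: Moore1966, Ch. 3 (interval arithmetic: inclusion property)] -/
theorem mem_schurE (hS : 0 < S) (ha0 : 0 < a) {ks : List PrimeLen} (hks : PrimeData a ks) {C : Consts}
    (hC : ConstsValid S a ks C) (χ : DirichletCharacter ℂ q) {εs : List ℤ}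
    (hε : ∀ i < ks.length, (χ (((ks.getD i default).val : ℕ) : ZMod q)).re = ((εs.getD i 0 : ℤ) : ℝ))
    {LQ : MI} (hLQ : MI.mem S (Real.log q) LQ) {N : ℕ} {tab : List IdxRec} (hT : TabValid S a ks N tab)
    {wbits : ℕ} {wN : List ℕ} {B i j : ℕ} (hi : i < N) (hj : j < N) :
    ∀ n, B + n ≤ N → (∀ c < n, 0 < wN.getD c 0) →
      MI.mem S (∑ c ∈ Finset.range n, evenKernel (twistedGramCoeff χ a) i (B + c) *
          evenKernel (twistedGramCoeff χ a) j (B + c) / ((wN.getD c 0 : ℝ) / 2 ^ wbits))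
        (schurE S C εs LQ tab wbits wN B i j n)
  | 0, _, _ => by simpa [schurE] using MI.mem_ofInt S 0
  | n + 1, hn, hw => by
      rw [Finset.sum_range_succ, schurE]
      have hmN : B + n < N := by omega
      have hwn : 0 < wN.getD n 0 := hw n (by omega)
      refine MI.mem_add (mem_schurE hS ha0 hks hC χ hε hLQ hT hi hj n (by omega) (fun c hc ↦ hw c (by omega))) ?_
      have h := MI.mem_divNat (MI.mem_mulInt (MI.mem_mul hS
        (mem_evenBoxT hS ha0 hks hC χ hε hLQ hT hi hmN) (mem_evenBoxT hS ha0 hks hC χ hε hLQ hT hj hmN))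
        ((2 : ℤ) ^ wbits)) hwn
      refine mem_of_eq h ?_
      have hw0 : (wN.getD n 0 : ℝ) ≠ 0 := by exact_mod_cast hwn.ne'
      push_cast
      field_simp

/-! ## Scalar boxes: `Σ`, and the order-1 tail `U₂⁺` -/

/-- `Σ_{i<k} wts_i` — box of `Σ = Σ_{log k<2a} Λ(k)k^{-1/2}`. [cite: Yoshida1992HermitianForms, §5 (5.15) p. 301] -/
def sigSum (S : ℕ) (wts : List MI) : ℕ → MI
  | 0 => MI.ofInt S 0
  | i + 1 => (sigSum S wts i).add (wts.getD i default)

/-- Soundness of `sigSum`. [cite: Moore1966, Ch. 3 (interval arithmetic: inclusion property)] -/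
theorem mem_sigSum {ks : List PrimeLen} {C : Consts} (hC : ConstsValid S a ks C) :
    ∀ k, k ≤ ks.length → MI.mem S (∑ i ∈ Finset.range k, (ks.getD i default).wt) (sigSum S C.wts k)
  | 0, _ => by simpa [sigSum] using MI.mem_ofInt S 0
  | k + 1, hk => by
      rw [Finset.sum_range_succ, sigSum]
      exact MI.mem_add (mem_sigSum hC k (by omega)) (hC.wts k hk)

/-- `Σ_{k ∈ weilPrimeIndex a} Λ(k)/√k = Σ_i wt_i` on the prime data. [cite: Yoshida1992HermitianForms, §5 (5.15) p. 301] -/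
theorem sum_weilPrimeIndex_eq_sum_wt {ks : List PrimeLen} (hks : PrimeData a ks) :
    (∑ k ∈ weilPrimeIndex a, (Λ k : ℝ) / Real.sqrt k) = ∑ i ∈ Finset.range ks.length, (ks.getD i default).wt := by
  have h := sum_weilPrimeIndex_eq_listSum hks (fun _ ↦ (1 : ℝ))
  simp only [mul_one] at h
  rw [h, list_sum_map_eq_sum_range]

/-- Box of `Σ`. [cite: Moore1966, Ch. 3 (interval arithmetic: inclusion property)] -/
def sigBox (S : ℕ) (C : Consts) : MI := sigSum S C.wts C.wts.length

/-- Soundness of `sigBox`. [cite: Moore1966, Ch. 3 (interval arithmetic: inclusion property)] -/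
theorem mem_sigBox {ks : List PrimeLen} (hks : PrimeData a ks) {C : Consts} (hC : ConstsValid S a ks C) :
    MI.mem S (∑ k ∈ weilPrimeIndex a, (Λ k : ℝ) / Real.sqrt k) (sigBox S C) := by
  rw [sum_weilPrimeIndex_eq_sum_wt hks, sigBox, hC.wts_len]
  exact mem_sigSum hC ks.length le_rfl

/-- The cell's rational data and scalar boxes for the even sector: block `B`, columns `[B, B₃)`, `θ = θN/θD`, unit
`2^{−wbits}` for `d₀ = d0N·2^{−wbits}` and the weights `w_{B+c} = wN_c·2^{−wbits}`; `CC ∋ a(1 + weilArchDensity(2a))`. -/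
structure EvenCellData where
  /-- block size -/
  B : ℕ
  /-- column cut -/
  B3 : ℕ
  /-- `θ` numerator -/
  θN : ℕ
  /-- `θ` denominator -/
  θD : ℕ
  /-- binary unit of `d₀` and the weights -/
  wbits : ℕ
  /-- `d₀ · 2^{wbits}` -/
  d0N : ℕ
  /-- `w_{B+c} · 2^{wbits}`, `c < B₃ − B` -/
  wN : List ℕ
  /-- box of `a(1 + weilArchDensity(2a))` -/
  CC : MI
  /-- box of `A_op⁺(a) = Σ_{log k<2a} Λ(k)k^{-1/2}·2cos(π/(⌊2a/log k⌋ + 2))` -/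
  AOP : MI
  /-- a rational `r8N/r8D ≥ √(8/(B−1))` (numerator) -/
  r8N : ℕ
  /-- (denominator) -/
  r8D : ℕ
  deriving Repr, Inhabited

/-- The rank-one coefficient `c_R = (1+θ)·((1 + 4Σ/π)/4)²/(d₀(B₃−1))` of `U₂⁺`, boxed. [cite: Yoshida1992HermitianForms, §7 pp. 305–312] -/
def cRBox (S : ℕ) (C : Consts) (d : EvenCellData) : MI :=
  let R := ((MI.ofInt S 1).add (((sigBox S C).mul S C.invPi).mulInt 4)).divNat 4
  ((((R.mul S R).mulInt ((d.θD : ℤ) + d.θN)).divNat d.θD).mulInt ((2 : ℤ) ^ d.wbits)).divNat (d.d0N * (d.B3 - 1))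

/-- The diagonal coefficient `c_D(i) = (1+θ⁻¹)·B/(d₀B₃²(B₃−1))·κ(i)²`, `κ(i) = 2iΣ/π + i/2 + 8a(1+E)/(3π²)`, boxed.
[cite: Yoshida1992HermitianForms, §7 pp. 305–312] -/
def cDBox (S : ℕ) (C : Consts) (d : EvenCellData) (i : ℕ) : MI :=
  let κ := ((((sigBox S C).mul S C.invPi).mulInt (2 * (i : ℤ))).add (MI.ofFrac S i 2)).add
    ((((d.CC.mul S C.invPi).mul S C.invPi).mulInt 8).divNat 3)
  (((((κ.mul S κ).mulInt ((d.θN : ℤ) + d.θD)).divNat d.θN).mulInt ((d.B : ℤ) * 2 ^ d.wbits)).divNat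
    (d.d0N * (d.B3 ^ 2 * (d.B3 - 1))))

/-- Box of `U₂⁺(i,j) = c_R·(−1)^i(−1)^j + δ_{ij} c_D(i)`. [cite: Yoshida1992HermitianForms, §7 pp. 305–312] -/
def u2E (S : ℕ) (C : Consts) (d : EvenCellData) (i j : ℕ) : MI :=
  ((cRBox S C d).mulInt (Encl.sgn i j)).add (if i = j then cDBox S C d i else MI.ofInt S 0)

/-- The boxed entry of the door's even-sector matrix `S⁺(i,j)`. [cite: Yoshida1992HermitianForms, §7 pp. 305–312] -/
def cellE (S : ℕ) (C : Consts) (εs : List ℤ) (LQ : MI) (tab : List IdxRec) (d : EvenCellData) (i j : ℕ) : MI :=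
  ((evenBoxT S C εs LQ tab i j).sub (schurE S C εs LQ tab d.wbits d.wN d.B i j (d.B3 - d.B))).sub (u2E S C d i j)

/-- Check integer data `D` (unit `2^{−c}`, radius `ρ`) against every boxed entry `S⁺(i,j)`, `i, j < B`, and the shape of the
rational data (`θ > 0`, `d₀ > 0`, `w > 0`, `2B ≤ B₃`). [cite: Moore1966, Ch. 3 (interval arithmetic: inclusion property)] -/
def checkCellE (S : ℕ) (C : Consts) (εs : List ℤ) (LQ : MI) (tab : List IdxRec) (d : EvenCellData) (c : ℕ) (ρ : ℤ)
    (D : List (List ℤ)) : Bool :=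
  decide (2 ≤ d.B) && decide (2 * d.B ≤ d.B3) && decide (0 < d.θN) && decide (0 < d.θD) && decide (0 < d.d0N) &&
    (List.range (d.B3 - d.B)).all (fun c' ↦ decide (0 < d.wN.getD c' 0)) &&
    (List.range d.B).all fun i ↦ (List.range d.B).all fun j ↦
      enclCheck S c ρ (PsdDyadic.getMZ D i j) (cellE S C εs LQ tab d i j)

/-! ## Soundness -/

/-- The real `U₂⁺(i,j)` of the door, as a function of the scalars. [cite: Yoshida1992HermitianForms, §7 pp. 305–312] -/
noncomputable def u2Real (Sig a' E θ d0 : ℝ) (B B3 : ℕ) (i j : ℕ) : ℝ :=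
  (1 + θ) * ((1 + 4 / π * Sig) / 4) ^ 2 / (d0 * ((B3 - 1 : ℕ) : ℝ)) * ((-1 : ℝ) ^ i * (-1 : ℝ) ^ j) +
    (if i = j then (1 + θ⁻¹) * (B / (d0 * ((B3 : ℝ) ^ 2 * ((B3 - 1 : ℕ) : ℝ)))) *
      (2 * i * Sig / π + ((i : ℝ) / 2 + 8 * a' * (1 + E) / (3 * π ^ 2))) ^ 2 else 0)

/-- Soundness of `u2E`. [cite: Moore1966, Ch. 3 (interval arithmetic: inclusion property)] -/
theorem mem_u2E (hS : 0 < S) {ks : List PrimeLen} (hks : PrimeData a ks) {C : Consts} (hC : ConstsValid S a ks C)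
    {d : EvenCellData} (hθN : 0 < d.θN) (hθD : 0 < d.θD) (hd0 : 0 < d.d0N) (hB3 : 2 ≤ d.B3) {E : ℝ}
    (hCC : MI.mem S (a * (1 + E)) d.CC) (i j : ℕ) :
    MI.mem S (u2Real (∑ k ∈ weilPrimeIndex a, (Λ k : ℝ) / Real.sqrt k) a E ((d.θN : ℝ) / d.θD)
      ((d.d0N : ℝ) / 2 ^ d.wbits) d.B d.B3 i j) (u2E S C d i j) := by
  have hSig := mem_sigBox hks hC
  have hπ := hC.invPi
  -- rank-one coefficient
  have hR : MI.mem S ((1 + 4 / π * ∑ k ∈ weilPrimeIndex a, (Λ k : ℝ) / Real.sqrt k) / 4)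
      (((MI.ofInt S 1).add (((sigBox S C).mul S C.invPi).mulInt 4)).divNat 4) := by
    refine mem_of_eq (MI.mem_divNat (MI.mem_add (MI.mem_ofInt S 1) (MI.mem_mulInt (MI.mem_mul hS hSig hπ) 4))
      (n := 4) (by norm_num)) ?_
    push_cast; ring
  have hB31 : 0 < d.B3 - 1 := by omega
  have hcR : MI.mem S ((1 + (d.θN : ℝ) / d.θD) * ((1 + 4 / π * ∑ k ∈ weilPrimeIndex a, (Λ k : ℝ) / Real.sqrt k) / 4) ^ 2 /
      ((d.d0N : ℝ) / 2 ^ d.wbits * ((d.B3 - 1 : ℕ) : ℝ))) (cRBox S C d) := by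
    unfold cRBox
    have h := MI.mem_divNat (MI.mem_mulInt (MI.mem_divNat (MI.mem_mulInt (MI.mem_mul hS hR hR) ((d.θD : ℤ) + d.θN))
      hθD) ((2 : ℤ) ^ d.wbits)) (n := d.d0N * (d.B3 - 1)) (Nat.mul_pos hd0 hB31)
    refine mem_of_eq h ?_
    have hθD' : (d.θD : ℝ) ≠ 0 := by exact_mod_cast hθD.ne'
    have hd0' : (d.d0N : ℝ) ≠ 0 := by exact_mod_cast hd0.ne'
    have hB3' : ((d.B3 - 1 : ℕ) : ℝ) ≠ 0 := by exact_mod_cast hB31.ne'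
    push_cast
    field_simp
  -- diagonal coefficient
  have hκ : MI.mem S (2 * i * (∑ k ∈ weilPrimeIndex a, (Λ k : ℝ) / Real.sqrt k) / π + ((i : ℝ) / 2 + 8 * a * (1 + E) / (3 * π ^ 2)))
      (((((sigBox S C).mul S C.invPi).mulInt (2 * (i : ℤ))).add (MI.ofFrac S i 2)).add
        ((((d.CC.mul S C.invPi).mul S C.invPi).mulInt 8).divNat 3)) := by
    refine mem_of_eq (MI.mem_add (MI.mem_add (MI.mem_mulInt (MI.mem_mul hS hSig hπ) (2 * (i : ℤ)))
      (MI.mem_ofFrac S i (q := 2) (by norm_num)))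
      (MI.mem_divNat (MI.mem_mulInt (MI.mem_mul hS (MI.mem_mul hS hCC hπ) hπ) 8) (n := 3) (by norm_num))) ?_
    push_cast; ring
  have hcD : MI.mem S ((1 + ((d.θN : ℝ) / d.θD)⁻¹) * (d.B / ((d.d0N : ℝ) / 2 ^ d.wbits * ((d.B3 : ℝ) ^ 2 * ((d.B3 - 1 : ℕ) : ℝ)))) *
      (2 * i * (∑ k ∈ weilPrimeIndex a, (Λ k : ℝ) / Real.sqrt k) / π + ((i : ℝ) / 2 + 8 * a * (1 + E) / (3 * π ^ 2))) ^ 2)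
      (cDBox S C d i) := by
    unfold cDBox
    have h := MI.mem_divNat (MI.mem_mulInt (MI.mem_divNat (MI.mem_mulInt (MI.mem_mul hS hκ hκ) ((d.θN : ℤ) + d.θD))
      hθN) ((d.B : ℤ) * 2 ^ d.wbits)) (n := d.d0N * (d.B3 ^ 2 * (d.B3 - 1)))
      (Nat.mul_pos hd0 (Nat.mul_pos (by positivity) hB31))
    refine mem_of_eq h ?_
    have hθN' : (d.θN : ℝ) ≠ 0 := by exact_mod_cast hθN.ne'
    have hθD' : (d.θD : ℝ) ≠ 0 := by exact_mod_cast hθD.ne'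
    have hd0' : (d.d0N : ℝ) ≠ 0 := by exact_mod_cast hd0.ne'
    have hB3' : ((d.B3 - 1 : ℕ) : ℝ) ≠ 0 := by exact_mod_cast hB31.ne'
    have hB3'' : (d.B3 : ℝ) ≠ 0 := by exact_mod_cast (show d.B3 ≠ 0 by omega)
    push_cast
    field_simp
  unfold u2E u2Real
  refine MI.mem_add ?_ ?_
  · refine mem_of_eq (MI.mem_mulInt hcR (Encl.sgn i j)) ?_
    rw [show ((Encl.sgn i j : ℤ) : ℝ) = (-1 : ℝ) ^ ((i : ℤ) + j) from (neg_one_zpow_eq_sgn i j).symm, zpow_add₀ (by norm_num),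
      zpow_natCast, zpow_natCast]
  · by_cases hij : i = j
    · subst hij
      simp only [if_true]
      exact hcD
    · simp only [hij, if_false]; simpa using MI.mem_ofInt S 0

/-! ## The door's `hSe` from a checked cell -/

/-- Unpack `checkCellE`. [cite: Moore1966, Ch. 3 (interval arithmetic: inclusion property)] -/
theorem checkCellE_spec {C : Consts} {εs : List ℤ} {LQ : MI} {tab : List IdxRec} {d : EvenCellData} {c : ℕ} {ρ : ℤ}
    {D : List (List ℤ)} (h : checkCellE S C εs LQ tab d c ρ D = true) :
    2 ≤ d.B ∧ 2 * d.B ≤ d.B3 ∧ 0 < d.θN ∧ 0 < d.θD ∧ 0 < d.d0N ∧ (∀ c' < d.B3 - d.B, 0 < d.wN.getD c' 0) ∧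
      ∀ i < d.B, ∀ j < d.B, enclCheck S c ρ (PsdDyadic.getMZ D i j) (cellE S C εs LQ tab d i j) = true := by
  unfold checkCellE at h
  simp only [Bool.and_eq_true, decide_eq_true_eq, List.all_eq_true, List.mem_range] at h
  obtain ⟨⟨⟨⟨⟨⟨h1, h2⟩, h3⟩, h4⟩, h5⟩, h6⟩, h7⟩ := h
  exact ⟨h1, h2, h3, h4, h5, h6, fun i hi j hj ↦ h7 i hi j hj⟩

/-- ★ **The door's even-sector kernel fact `hSe` from a checked cell.**  Valid constants / prime data / character weights /
`log q` box / special-value table below `N ≥ B₃` / box `CC ∋ a(1 + weilArchDensity(2a))`; the cell check and the dyadic PSD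
certificate of the integer data `D` ⇒ for every `x : Fin B → ℝ`,
`0 ≤ Σ_i Σ_j x_i x_j (M⁺(i,j) − Σ_{m∈Ico B B₃} M⁺(i,m)M⁺(j,m)/w_m − U₂⁺(i,j))` with `w_m = wN_{m−B}·2^{−wbits}`, `θ = θN/θD`,
`d₀ = d0N·2^{−wbits}` — literally the hypothesis `hSe` of `weilPositivityOnChar_of_twisted_formatC_data`.
[cite: Yoshida1992HermitianForms, §7 pp. 305–312] -/
theorem hSe_of_checkCellE (hS : 0 < S) (ha0 : 0 < a) {ks : List PrimeLen} (hks : PrimeData a ks) {C : Consts}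
    (hC : ConstsValid S a ks C) (χ : DirichletCharacter ℂ q) {εs : List ℤ}
    (hε : ∀ i < ks.length, (χ (((ks.getD i default).val : ℕ) : ZMod q)).re = ((εs.getD i 0 : ℤ) : ℝ))
    {LQ : MI} (hLQ : MI.mem S (Real.log q) LQ) {N : ℕ} {tab : List IdxRec} (hT : TabValid S a ks N tab)
    {d : EvenCellData} (hN : d.B3 ≤ N) (hCC : MI.mem S (a * (1 + weilArchDensity (2 * a))) d.CC)
    {c : ℕ} {ρ δ : ℤ} {D L : List (List ℤ)} (hchk : checkCellE S C εs LQ tab d c ρ D = true)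
    (hpsd : PsdDyadic.checkPsdMid d.B δ ρ D L = true) :
    ∀ x : Fin d.B → ℝ, 0 ≤ ∑ i, ∑ j, x i * x j *
      ((if (i : ℕ) = 0 then twistedGramCoeff χ a 0 j else if (j : ℕ) = 0 then twistedGramCoeff χ a i 0
          else (twistedGramCoeff χ a i j + twistedGramCoeff χ a i (-(j : ℤ))) / 2)
        - (∑ m ∈ Finset.Ico d.B d.B3, (if (i : ℕ) = 0 then twistedGramCoeff χ a 0 m else if m = 0 then twistedGramCoeff χ a i 0
            else (twistedGramCoeff χ a i m + twistedGramCoeff χ a i (-(m : ℤ))) / 2) *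
            (if (j : ℕ) = 0 then twistedGramCoeff χ a 0 m else if m = 0 then twistedGramCoeff χ a j 0
            else (twistedGramCoeff χ a j m + twistedGramCoeff χ a j (-(m : ℤ))) / 2) /
            ((d.wN.getD (m - d.B) 0 : ℝ) / 2 ^ d.wbits))
        - ((1 + ((d.θN : ℝ) / d.θD)) * ((1 + 4 / π * (∑ k ∈ weilPrimeIndex a, (Λ k : ℝ) / Real.sqrt k)) / 4) ^ 2 /
              (((d.d0N : ℝ) / 2 ^ d.wbits) * ((d.B3 - 1 : ℕ) : ℝ)) * ((-1 : ℝ) ^ (i : ℕ) * (-1 : ℝ) ^ (j : ℕ)) +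
            (if i = j then (1 + ((d.θN : ℝ) / d.θD)⁻¹) * (d.B / (((d.d0N : ℝ) / 2 ^ d.wbits) * ((d.B3 : ℝ) ^ 2 * ((d.B3 - 1 : ℕ) : ℝ)))) *
              (2 * (i : ℕ) * (∑ k ∈ weilPrimeIndex a, (Λ k : ℝ) / Real.sqrt k) / π +
                (((i : ℕ) : ℝ) / 2 + 8 * a * (1 + weilArchDensity (2 * a)) / (3 * π ^ 2))) ^ 2 else 0))) := by
  obtain ⟨hB2, hBB3, hθN, hθD, hd0, hw, hrows⟩ := checkCellE_spec hchk
  set G : ℤ → ℤ → ℝ := twistedGramCoeff χ a with hG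
  set Sig : ℝ := ∑ k ∈ weilPrimeIndex a, (Λ k : ℝ) / Real.sqrt k with hSigdef
  -- the real matrix enclosed by `cellE`
  set Sr : ℕ → ℕ → ℝ := fun i j ↦ evenKernel G i j -
      (∑ c' ∈ Finset.range (d.B3 - d.B), evenKernel G i (d.B + c') * evenKernel G j (d.B + c') /
        ((d.wN.getD c' 0 : ℝ) / 2 ^ d.wbits)) -
      u2Real Sig a (weilArchDensity (2 * a)) ((d.θN : ℝ) / d.θD) ((d.d0N : ℝ) / 2 ^ d.wbits) d.B d.B3 i j with hSr
  have hmem : ∀ i < d.B, ∀ j < d.B, MI.mem S (Sr i j) (cellE S C εs LQ tab d i j) := by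
    intro i hi j hj
    have hiN : i < N := by omega
    have hjN : j < N := by omega
    exact MI.mem_sub (MI.mem_sub (mem_evenBoxT hS ha0 hks hC χ hε hLQ hT hiN hjN)
      (mem_schurE hS ha0 hks hC χ hε hLQ hT hiN hjN (d.B3 - d.B) (by omega) hw))
      (mem_u2E hS hks hC hθN hθD hd0 (by omega) hCC i j)
  have hnear : ∀ i j : Fin d.B, |Sr i j - (PsdDyadic.getMZ D i j : ℝ) * (1 / 2 ^ c)| ≤ (ρ : ℝ) * (1 / 2 ^ c) :=
    fun i j ↦ abs_sub_le_of_enclCheck hS (hrows i i.isLt j j.isLt) (hmem i i.isLt j j.isLt)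
  have hpsd' := PsdDyadic.psd_of_checkPsdMid hpsd (u := 1 / 2 ^ c) (by positivity) (fun i j ↦ Sr i j) hnear
  intro x
  have key := hpsd' x
  -- identify the door's entries with `Sr`
  have hIco : ∀ (f : ℕ → ℝ), ∑ m ∈ Finset.Ico d.B d.B3, f m = ∑ c' ∈ Finset.range (d.B3 - d.B), f (d.B + c') :=
    fun f ↦ Finset.sum_Ico_eq_sum_range f d.B d.B3
  refine key.trans_eq (Finset.sum_congr rfl fun i _ ↦ Finset.sum_congr rfl fun j _ ↦ ?_)
  congr 1
  simp only [hSr, hG, hSigdef, evenKernel, u2Real, hIco, Nat.add_sub_cancel_left, Fin.val_inj]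

end TwistedEncl

end Summit.Ventures.WeilGRH
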